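import Summits.Ventures.Crystal3D.Theorems.StickyWulffConstantTextureLiminfUnsaturate
import Summits.Ventures.Crystal3D.Theorems.StickyWulffConstantTextureLiminfTexShadowVocabularyV5
import HarnessLib

/-!
# Line `TexShadow` at LAW v5 — the SATURATION WLOG at every law `(c₀, c₁)` (T-V5 PORT, file P2)
# (lane T; crux `TextureLiminfV5`, stmt-Ventures-23912; cf-p1 g30 memo HOME/cf-p1/T-V5-PORT.md P2)

HONEST FRAMING. Venture `Summits/Ventures/Crystal3D` (cell `crystal3d-full`), route `route-Ventures-StickyWulffConstant`, helper
`--supports` the law-v5 crux `TextureLiminfV5` (stmt-Ventures-23912).  Pure proof, standard axioms; rung F-C1 not moved.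

`shadowTheoremAt_of_sat : ShadowTheoremSatAt c₀ c₁ GWF CWL → ShadowTheoremAt c₀ c₁ GWF CWL` for EVERY law `(c₀, c₁)` and every
pair of wall siblings `(GWF, CWL)` — the proof of `shadowTheorem_of_shadowTheoremSat` (…TextureLiminfUnsaturate §5, v6.2, law
`(1, ½)`) VERBATIM: saturate (`exists_saturated`, law-free), apply the saturated theorem at `(2K₊, δ/2, θ/2)`, dilate the texture by
`λ = (N'/N)^{1/3}` (`isTexture_smul` is stated for all `c₀ c₁`; `energy_smul`, `vol_smul`).  Instances: `shadowTheoremV5_of_sat`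
(TexShadow v7's `stub_unsaturate` at law v5) and, through `shadowTheorem_iff_at`, the v4 statement again.
WHAT THIS IS NOT: any progress on `stub_textureBuild` or the wall laws; F-C1 not moved.
-/

open scoped BigOperators InnerProductSpace ENNReal Pointwise
open MeasureTheory Filter Finset

namespace Summit.Ventures.Crystal3D.Cruxes.TextureLiminf.TexShadow

open Summit.Ventures.Crystal3D

/-- cube-root bookkeeping: `0 ≤ a`, `a³ ≤ N` ⇒ `a · N^{2/3} ≤ N` (private copy of the v6.2 lemma). -/
private theorem mul_rpow_two_thirds_le' {a N : ℝ} (ha : 0 ≤ a) (hN : 0 ≤ N) (h : a ^ 3 ≤ N) :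
    a * N ^ ((2 : ℝ) / 3) ≤ N := by
  have h13 : a ≤ N ^ ((1 : ℝ) / 3) := by
    calc a = (a ^ 3) ^ ((1 : ℝ) / 3) := by
          rw [← Real.rpow_natCast, ← Real.rpow_mul ha]; norm_num
      _ ≤ N ^ ((1 : ℝ) / 3) := Real.rpow_le_rpow (pow_nonneg ha 3) h (by norm_num)
  calc a * N ^ ((2 : ℝ) / 3) ≤ N ^ ((1 : ℝ) / 3) * N ^ ((2 : ℝ) / 3) :=
        mul_le_mul_of_nonneg_right h13 (Real.rpow_nonneg hN _)
    _ = N ^ ((1 : ℝ) / 3 + (2 : ℝ) / 3) := (Real.rpow_add' hN (by norm_num)).symm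
    _ = N := by norm_num

/-- **The saturation WLOG at every law**: the shadow theorem for 6|6-saturated clusters at law `(c₀, c₁)` with wall siblings
`(GWF, CWL)` implies the shadow theorem at the same law.  Proof = `shadowTheorem_of_shadowTheoremSat` verbatim (saturate by
`exists_saturated`; apply the saturated theorem with `(2Kp, δ/2, θ/2)`, `Kp = max K 0`; for `N ≥ (2Kp)³, (2Kp/δ)³, 2N₀' + 1` one
has `N/2 ≤ N' ≤ 3N/2`, `N' ≥ (1 − δ/2)N`, `D' ≤ 2Kp N'^{2/3}`; dilate by `λ = (N'/N)^{1/3}`). -/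
theorem shadowTheoremAt_of_sat {c₀ c₁ : ℝ} {GWF CWL : Prop} (hSat : ShadowTheoremSatAt c₀ c₁ GWF CWL) :
    ShadowTheoremAt c₀ c₁ GWF CWL := by
  intro hG hF hNRG hSL K δ θ hδ hθ
  -- nonnegative version of `K`
  set Kp : ℝ := max K 0 with hKp
  have hKp0 : 0 ≤ Kp := le_max_right _ _
  have hKK : K ≤ Kp := le_max_left _ _
  obtain ⟨N₀', hN₀'⟩ := hSat hG hF hNRG hSL (2 * Kp) (δ / 2) (θ / 2) (by positivity) (by positivity)
  obtain ⟨M, hM⟩ := exists_nat_ge (max ((2 * Kp) ^ 3) ((2 * Kp / δ) ^ 3))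
  refine ⟨M + 2 * N₀' + 1, fun N hN x hx hD => ?_⟩
  have hN1 : (1 : ℝ) ≤ N := by exact_mod_cast (show 1 ≤ N by omega)
  have hNpos : (0 : ℝ) < N := by linarith
  have hNM : (M : ℝ) ≤ N := by exact_mod_cast (show M ≤ N by omega)
  have hN₀'N : 2 * (N₀' : ℝ) + 1 ≤ N := by exact_mod_cast (show 2 * N₀' + 1 ≤ N by omega)
  have hNr0 : (0 : ℝ) ≤ (N : ℝ) ^ ((2 : ℝ) / 3) := Real.rpow_nonneg hNpos.le _
  -- the two cube-root bounds on `B = Kp N^{2/3}`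
  have hB1 : Kp * (N : ℝ) ^ ((2 : ℝ) / 3) ≤ N / 2 := by
    have h : (2 * Kp) ^ 3 ≤ (N : ℝ) := (le_max_left _ _).trans (hM.trans hNM)
    have := mul_rpow_two_thirds_le' (by positivity) hNpos.le h
    linarith
  have hB2 : Kp * (N : ℝ) ^ ((2 : ℝ) / 3) ≤ δ / 2 * N := by
    have h : (2 * Kp / δ) ^ 3 ≤ (N : ℝ) := (le_max_right _ _).trans (hM.trans hNM)
    have h' := mul_rpow_two_thirds_le' (by positivity) hNpos.le h
    have heq : Kp * (N : ℝ) ^ ((2 : ℝ) / 3) = δ / 2 * (2 * Kp / δ * (N : ℝ) ^ ((2 : ℝ) / 3)) := by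
      field_simp
    rw [heq]
    exact mul_le_mul_of_nonneg_left h' (by positivity)
  have hDK : 6 * (N : ℝ) - (numContacts x : ℝ) ≤ Kp * (N : ℝ) ^ ((2 : ℝ) / 3) :=
    hD.trans (mul_le_mul_of_nonneg_right hKK hNr0)
  -- saturate
  obtain ⟨N', x', s, hx', hsat', hNle, hN'le, hD's, -⟩ := exists_saturated x hx
  have hs0 : (0 : ℝ) ≤ s := Nat.cast_nonneg _
  have hC' : (numContacts x' : ℝ) ≤ 6 * N' := by exact_mod_cast numContacts_le_six_mul hx'
  have hD'0 : (0 : ℝ) ≤ 6 * (N' : ℝ) - (numContacts x' : ℝ) := by linarith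
  have hsB : (s : ℝ) ≤ Kp * (N : ℝ) ^ ((2 : ℝ) / 3) := by linarith
  -- size of `N'`
  have hN'lo : (N : ℝ) / 2 ≤ N' := by linarith
  have hN'lo' : (1 - δ / 2) * N ≤ N' := by linarith
  have hN'hi : (N' : ℝ) ≤ 3 / 2 * N := by linarith
  have hN'pos : (0 : ℝ) < N' := by linarith
  have hN'ge : N₀' ≤ N' := by exact_mod_cast (show (N₀' : ℝ) ≤ N' by linarith)
  have hN'r0 : (0 : ℝ) ≤ (N' : ℝ) ^ ((2 : ℝ) / 3) := Real.rpow_nonneg hN'pos.le _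
  -- deficiency bound for the saturated cluster
  have hD'K : 6 * (N' : ℝ) - (numContacts x' : ℝ) ≤ 2 * Kp * (N' : ℝ) ^ ((2 : ℝ) / 3) := by
    have h1 : 6 * (N' : ℝ) - (numContacts x' : ℝ) ≤ Kp * (N : ℝ) ^ ((2 : ℝ) / 3) := by linarith
    have h2 : (N : ℝ) ^ ((2 : ℝ) / 3) ≤ (2 * (N' : ℝ)) ^ ((2 : ℝ) / 3) :=
      Real.rpow_le_rpow hNpos.le (by linarith) (by norm_num)
    have h3 : (2 * (N' : ℝ)) ^ ((2 : ℝ) / 3) = (2 : ℝ) ^ ((2 : ℝ) / 3) * (N' : ℝ) ^ ((2 : ℝ) / 3) :=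
      Real.mul_rpow (by norm_num) hN'pos.le
    have h4 : (2 : ℝ) ^ ((2 : ℝ) / 3) ≤ 2 := by
      conv_rhs => rw [← Real.rpow_one 2]
      exact Real.rpow_le_rpow_of_exponent_le (by norm_num) (by norm_num)
    calc 6 * (N' : ℝ) - (numContacts x' : ℝ) ≤ Kp * (N : ℝ) ^ ((2 : ℝ) / 3) := h1
      _ ≤ Kp * ((2 : ℝ) ^ ((2 : ℝ) / 3) * (N' : ℝ) ^ ((2 : ℝ) / 3)) := by
          rw [← h3]; exact mul_le_mul_of_nonneg_left h2 hKp0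
      _ ≤ Kp * (2 * (N' : ℝ) ^ ((2 : ℝ) / 3)) :=
          mul_le_mul_of_nonneg_left (mul_le_mul_of_nonneg_right h4 hN'r0) hKp0
      _ = 2 * Kp * (N' : ℝ) ^ ((2 : ℝ) / 3) := by ring
  -- the saturated theorem gives a texture for `x'`
  obtain ⟨n, G, A, c, m, hT, hvol, hEn⟩ := hN₀' N' hN'ge x' hx' hsat' hD'K
  -- dilation factor `λ = (N'/N)^{1/3}`
  set t : ℝ := (N' : ℝ) / N with ht
  have ht0 : 0 < t := by positivity
  set lam : ℝ := t ^ ((1 : ℝ) / 3) with hlam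
  have hlam0 : 0 < lam := Real.rpow_pos_of_pos ht0 _
  have hlam3 : lam ^ 3 = t := by
    rw [hlam, ← Real.rpow_natCast, ← Real.rpow_mul ht0.le]; norm_num
  have hlam2 : lam ^ 2 = t ^ ((2 : ℝ) / 3) := by
    rw [hlam, ← Real.rpow_natCast, ← Real.rpow_mul ht0.le]; norm_num
  refine ⟨n, fun f => lam • G f, A, c, m, isTexture_smul hT hlam0, ?_, ?_⟩
  · -- mass: `√2 · t · vol ≥ (1 − δ/2)² ≥ 1 − δ`
    rw [vol_smul n G hlam0.le, hlam3]
    have hvol0 : 0 ≤ vol n G := ENNReal.toReal_nonneg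
    have ht1 : 1 - δ / 2 ≤ t := by
      rw [ht, le_div_iff₀ hNpos]; linarith
    by_cases hδ1 : δ / 2 ≤ 1
    · have h0 : 0 ≤ 1 - δ / 2 := by linarith
      calc 1 - δ ≤ (1 - δ / 2) * (1 - δ / 2) := by nlinarith
        _ ≤ t * (Real.sqrt 2 * vol n G) := mul_le_mul ht1 hvol h0 ht0.le
        _ = Real.sqrt 2 * (t * vol n G) := by ring
    · have : 0 ≤ Real.sqrt 2 * (t * vol n G) := by positivity
      linarith
  · -- energy: `t^{2/3} · (D'/N'^{2/3} + θ/2) = D'/N^{2/3} + t^{2/3} θ/2 ≤ D/N^{2/3} + θ`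
    rw [energy_smul n G A c m hlam0, hlam2]
    have hNr : (0 : ℝ) < (N : ℝ) ^ ((2 : ℝ) / 3) := Real.rpow_pos_of_pos hNpos _
    have hN'r : (0 : ℝ) < (N' : ℝ) ^ ((2 : ℝ) / 3) := Real.rpow_pos_of_pos hN'pos _
    have htr : t ^ ((2 : ℝ) / 3) = (N' : ℝ) ^ ((2 : ℝ) / 3) / (N : ℝ) ^ ((2 : ℝ) / 3) := by
      rw [ht, Real.div_rpow hN'pos.le hNpos.le]
    have ht32 : t ^ ((2 : ℝ) / 3) ≤ 3 / 2 := by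
      have ht' : t ≤ 3 / 2 := by rw [ht, div_le_iff₀ hNpos]; linarith
      calc t ^ ((2 : ℝ) / 3) ≤ (3 / 2 : ℝ) ^ ((2 : ℝ) / 3) := Real.rpow_le_rpow ht0.le ht' (by norm_num)
        _ ≤ (3 / 2 : ℝ) ^ (1 : ℝ) := Real.rpow_le_rpow_of_exponent_le (by norm_num) (by norm_num)
        _ = 3 / 2 := Real.rpow_one _
    have ht23_0 : 0 ≤ t ^ ((2 : ℝ) / 3) := Real.rpow_nonneg ht0.le _
    have h1 : t ^ ((2 : ℝ) / 3) * energy n G A c m ≤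
        t ^ ((2 : ℝ) / 3) * ((6 * (N' : ℝ) - (numContacts x' : ℝ)) / (N' : ℝ) ^ ((2 : ℝ) / 3) + θ / 2) :=
      mul_le_mul_of_nonneg_left hEn ht23_0
    have h2 : t ^ ((2 : ℝ) / 3) * ((6 * (N' : ℝ) - (numContacts x' : ℝ)) / (N' : ℝ) ^ ((2 : ℝ) / 3)) =
        (6 * (N' : ℝ) - (numContacts x' : ℝ)) / (N : ℝ) ^ ((2 : ℝ) / 3) := by
      rw [htr]; field_simp
    have h3 : (6 * (N' : ℝ) - (numContacts x' : ℝ)) / (N : ℝ) ^ ((2 : ℝ) / 3) ≤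
        (6 * (N : ℝ) - (numContacts x : ℝ)) / (N : ℝ) ^ ((2 : ℝ) / 3) :=
      div_le_div_of_nonneg_right (by linarith) hNr.le
    have h4 : t ^ ((2 : ℝ) / 3) * (θ / 2) ≤ 3 / 2 * (θ / 2) :=
      mul_le_mul_of_nonneg_right ht32 (by positivity)
    calc t ^ ((2 : ℝ) / 3) * energy n G A c m
        ≤ t ^ ((2 : ℝ) / 3) * ((6 * (N' : ℝ) - (numContacts x' : ℝ)) / (N' : ℝ) ^ ((2 : ℝ) / 3) + θ / 2) := h1
      _ = (6 * (N' : ℝ) - (numContacts x' : ℝ)) / (N : ℝ) ^ ((2 : ℝ) / 3) + t ^ ((2 : ℝ) / 3) * (θ / 2) := by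
          rw [mul_add, h2]
      _ ≤ (6 * (N : ℝ) - (numContacts x : ℝ)) / (N : ℝ) ^ ((2 : ℝ) / 3) + θ := by linarith

/-- **TexShadow v7's `stub_unsaturate`**: the saturated shadow theorem at law v5 implies the shadow theorem at law v5. -/
theorem shadowTheoremV5_of_sat (h : ShadowTheoremSatV5) : ShadowTheoremV5 := shadowTheoremAt_of_sat h

end Summit.Ventures.Crystal3D.Cruxes.TextureLiminf.TexShadow
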